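import Summits.QuantumFields.YangMills.Theorems.BalabanUVNodesK2JsOfRecord

/-! # CRIT-2 g3 — scratch: FADED linear box currency is F-E-robust (escapes the blindness collapse) and still gives the box-SIZE modulus (⟹ `ScaleAnchor`). -/

open Filter Topology Finset
open Literature.MathematicalPhysics.QuantumFieldTheory.Balaban1983to89
open Literature.MathematicalPhysics.QuantumFieldTheory.Balaban1983to89.FlowStep
open Literature.MathematicalPhysics.QuantumFieldTheory.Balaban1983to89.B12Beta (HistBox)

namespace Crit2Faded

/-- FADED linear box remainder: `|β k p − b k| ≤ ∑ i, Λ k i · p i` on the box, with geometric fading `∑ i, Λ k i · θ^{-(k-i)}`-type control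
packaged crudely as `∑ i, Λ k i ≤ C` (total mass) — enough for the box-SIZE modulus. [folklore] -/
def FadedBoxRemainder (β : HBeta) (b : ℕ → ℝ) (Λ : ℕ → ℕ → ℝ) (γ₀ : ℝ) : Prop :=
  (∀ k i, 0 ≤ Λ k i) ∧ ∀ (k : ℕ) (p : Fin (k + 1) → ℝ), p ∈ HistBox γ₀ k → |β k p - b k| ≤ ∑ i : Fin (k + 1), Λ k i * p i

/-- Box-SIZE modulus from a faded remainder with bounded total mass: `|β k p − b k| ≤ C·γ` on `HistBox γ k`, `γ ≤ γ₀`. [folklore] -/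
theorem boxSize_of_faded {β : HBeta} {b : ℕ → ℝ} {Λ : ℕ → ℕ → ℝ} {γ₀ C : ℝ}
    (h : FadedBoxRemainder β b Λ γ₀) (hmass : ∀ k, ∑ i : Fin (k + 1), Λ k i ≤ C)
    {γ : ℝ} (hγ : γ ≤ γ₀) (k : ℕ) (p : Fin (k + 1) → ℝ) (hp : p ∈ HistBox γ k) :
    |β k p - b k| ≤ C * γ := by
  have hp₀ : p ∈ HistBox γ₀ k := fun i => ⟨(hp i).1, (hp i).2.trans hγ⟩
  have hγpos : 0 ≤ γ := by
    have := hp (Fin.last k); exact le_trans this.1.le this.2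
  calc |β k p - b k| ≤ ∑ i : Fin (k + 1), Λ k i * p i := h.2 k p hp₀
    _ ≤ ∑ i : Fin (k + 1), Λ k i * γ := by
        apply Finset.sum_le_sum; intro i _
        exact mul_le_mul_of_nonneg_left (hp i).2 (h.1 k i)
    _ = (∑ i : Fin (k + 1), Λ k i) * γ := by rw [Finset.sum_mul]
    _ ≤ C * γ := mul_le_mul_of_nonneg_right (hmass k) hγpos

/-- the weight family of the witness: all mass `ρ^k` on the first entry. [folklore] -/
def firstWeight (ρ : ℝ) (k i : ℕ) : ℝ := if i = 0 then ρ ^ k else 0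

theorem sum_firstWeight (ρ : ℝ) (k : ℕ) : ∑ i : Fin (k + 1), firstWeight ρ k i = ρ ^ k := by
  rw [Finset.sum_eq_single (0 : Fin (k + 1))]
  · simp [firstWeight]
  · intro i _ hi; have : (i : ℕ) ≠ 0 := fun h => hi (Fin.ext h); simp [firstWeight, this]
  · simp

theorem sum_firstWeight_mul (ρ : ℝ) (k : ℕ) (p : Fin (k + 1) → ℝ) : ∑ i : Fin (k + 1), firstWeight ρ k i * p i = ρ ^ k * p 0 := by
  rw [Finset.sum_eq_single (0 : Fin (k + 1))]
  · simp [firstWeight]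
  · intro i _ hi; have : (i : ℕ) ≠ 0 := fun h => hi (Fin.ext h); simp [firstWeight, this]
  · simp

/-- the witness β: reads the FIRST entry only, damped geometrically in the scale. [folklore] -/
def betaFirst (ρ : ℝ) : HBeta := fun k p => ρ ^ k * p 0

/-- F-E ROBUSTNESS WITNESS: `betaFirst ρ` is last-entry BLIND from scale 1, carries the faded remainder towards `b ≡ 0` with weights `firstWeight ρ`
(total mass `ρ^k ≤ 1`), and is NOT box-constant at any scale when `0 < ρ` — so the FADED currency is NOT collapsed by blindness
(contrast `Crit2LastEntryBlind.boxConst_of_blind_boxModulus` for the LAST-ENTRY currency). [folklore] -/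
theorem faded_blind_witness {ρ : ℝ} (hρ0 : 0 ≤ ρ) (hρ1 : ρ ≤ 1) {γ₀ : ℝ} (hγ : 0 < γ₀) :
    (∀ k : ℕ, 1 ≤ k → ∀ (p : Fin (k + 1) → ℝ) (t : ℝ), 0 < t → betaFirst ρ k p = betaFirst ρ k (Function.update p (Fin.last k) t)) ∧
    FadedBoxRemainder (betaFirst ρ) (fun _ => 0) (firstWeight ρ) γ₀ ∧
    (∀ k, ∑ i : Fin (k + 1), firstWeight ρ k i ≤ 1) ∧
    (0 < ρ → ∀ k, ∃ p ∈ HistBox γ₀ k, ∃ q ∈ HistBox γ₀ k, betaFirst ρ k p ≠ betaFirst ρ k q) := by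
  refine ⟨fun k hk p t _ => ?_, ⟨fun k i => ?_, fun k p hp => ?_⟩, fun k => ?_, fun hρ k => ?_⟩
  · have h0 : (0 : Fin (k + 1)) ≠ Fin.last k := by
      intro h; have := congrArg Fin.val h; simp at this; omega
    simp [betaFirst, Function.update_of_ne h0]
  · unfold firstWeight; split_ifs
    · exact pow_nonneg hρ0 k
    · exact le_rfl
  · rw [sum_firstWeight_mul, betaFirst, sub_zero, abs_of_nonneg (mul_nonneg (pow_nonneg hρ0 k) (hp 0).1.le)]
  · rw [sum_firstWeight]; exact pow_le_one₀ hρ0 hρ1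
  · refine ⟨fun _ => γ₀, fun i => ⟨hγ, le_rfl⟩, fun i => if i = 0 then γ₀ / 2 else γ₀, fun i => ?_, ?_⟩
    · by_cases hi : i = 0 <;> simp [hi, hγ, half_pos hγ, half_le_self hγ.le]
    · simp only [betaFirst]
      intro h
      have hρk : 0 < ρ ^ k := pow_pos hρ k
      have : γ₀ = γ₀ / 2 := by
        have := mul_left_cancel₀ hρk.ne' h; simpa using this
      linarith

end Crit2Faded
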